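import Mathlib.GroupTheory.Commensurable
import Mathlib.Topology.Algebra.OpenSubgroup
import Literature.AnabelianGeometry.SemiGraphs.ArithMaximalCompact
import Literature.AnabelianGeometry.SemiGraphs.ArithEstrangementNoBranchPair
import Literature.AnabelianGeometry.SemiGraphs.ArithDecompositionData
import Literature.AnabelianGeometry.SemiGraphs.ArithIntersectionWithGeometricProofs
import Literature.AnabelianGeometry.SemiGraphs.TemperedMaximalCompact
import HarnessLib

/-!
# [SemiAnbd] Rmk 5.3.1, first sentence: "all verticial and edge-like subgroups of `Π^temp_𝔊` are
# compact and arithmetically ample" — `VerticialEdgeLikeCompactAmpleStatement` discharged in layers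

Mochizuki, *Semi-graphs of anabelioids*, Publ. RIMS **42** (2006) 221–322, §5, Remark 5.3.1 (p. 65)
and the p. 65 description of the decomposition groups [cite: MochizukiSemiAnbd2006, Rmk 5.3.1 p.65].
PROOF-ONLY companion (abc-iut cell, sub-DAG Thm54 row T54-1, abc-iut-w4-d029 for the coordinator
abc-iut-w4-d085; the predicate is abc-iut-L3-t3's `VerticialEdgeLikeCompactAmpleStatement D aug`,
`ArithMaximalCompact.lean`, = the input `hR` of every Thm 5.4 (ii) assembly).  No definition is
introduced; every decomposition-theoretic input is an explicit binder.

* LAYER 0 (`verticialEdgeLikeCompactAmple_of_representatives`): the statement for ALL verticial /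
  edge-like subgroups follows from the two conjuncts for the chosen REPRESENTATIVES `D.vertGp v`,
  `D.brGp b` — compactness is transported along the homeomorphism "conjugation by `g`", ampleness by
  `isArithAmple_conjSubgroup_iff`.
* LAYER A, AMPLENESS, in the commensurator model of the decomposition groups PRODUCED from the tempered
  chart (`ArithDecompositionData.lean`, abc-iut-w4-d053: `arithVertGp R ι v = C_{Gtp}(ι Π^temp_{𝔾,v})`,
  `arithBrGp R ι b = arithVertGp R ι v ⊓ C_{Gtp}(ι Π^temp_{𝔾,b})`): print's reason is Def 5.1 (i)(c) — an
  open subgroup `U ≤ Π_A` acts trivially on the underlying semi-graph — together with Prop 3.6 (iv)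
  (conjugation by `g ∈ Π^temp_𝔊` carries the verticial subgroups at `v` to those at `(aug g) • v`) and the
  single conjugacy class of verticial subgroups at a vertex (Thm 3.7; `exists_conj_of_mem_verticialSubgroups`):
  for `a ∈ U` and a lift `g`, `g · ιΠ_{𝔾,v} · g⁻¹ = ι(h · Π_{𝔾,v} · h⁻¹)`, so `(ι h)⁻¹ g` NORMALISES `ιΠ_{𝔾,v}`,
  lies in the commensurator, and maps to `a`; hence `U ≤ aug(Π^temp_{𝔊,v})`, which is therefore open
  (`isArithAmple_arithVertGp`, hypotheses shaped as the fields `conj_verticial` / `exists_open_trivial`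
  of the producer's `ArithChartAction` package plus `aug ∘ ι = 1` and `aug` surjective).  For a BRANCH
  `b ↦ v` the same argument needs ONE element `h` conjugating the PAIR `(Π_{𝔾,v}, Π_{𝔾,b})`
  simultaneously (`isArithAmple_arithBrGp`, binder `hconjPair`): at tree level this is "Π^temp_𝔾 acts
  transitively on the tree branches over `b`, and `g · (ṽ, b̃)` lies over `(v, b)` when `aug g` fixes `v`
  and `b`"; the edge-granular field `conj_edgeLike` alone does NOT give it when the edge of `b` is a loop
  (both lifts of the loop at `ṽ` are edge-like at the same edge inside the same `Π_{𝔾,v}`) — recorded,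
  not smuggled.
* LAYER A, COMPACTNESS (`isCompact_commensurator_of_thickening`): in the commensurator model compactness
  of `C_{Gtp}(ιΠ_{𝔾,v})` is NOT formal; it is EQUIVALENT (given commensurable terminality of `Π_{𝔾,v}` in
  `Π^temp_𝔾` read through exactness, `C ⊓ ker aug ≤ ιΠ_{𝔾,v}`, and compactness of `Π_A`) to the existence
  of a compact arithmetically ample thickening `ιΠ_{𝔾,v} ≤ K ≤ C` — in print, the image of the profinite
  fundamental group of the constituent anabelioid `𝔊_v` restricted to `U`; producing such a `K` is the
  LEVEL-B obligation (construction of `Π^temp_𝔊`, plan/GAP-LEDGER G-w4d053-1), taken here as a binder.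
* TREE LEVEL (`isClosed_of_mem_iff_forall_fixes`): a subgroup cut out as the common stabiliser of a
  system of vertices under level actions with OPEN kernels (the producer's dictionary fields `fix`,
  `stab`) is closed (indeed each level stabiliser is clopen).

Typed ≠ proved for the INPUTS; nothing here bears on [IUTchIII] Cor. 3.12.
-/

namespace Literature.AnabelianGeometry.SemiGraphs

open Topology
open scoped Pointwise

universe u u' u''

/-! ### Layer 0: reduction to the representatives -/

section Reduction

variable {Gtp : Type u'} [Group Gtp] [TopologicalSpace Gtp] [IsTopologicalGroup Gtp]
  {PA : Type u''} [Group PA] [TopologicalSpace PA] [IsTopologicalGroup PA]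
  {V B : Type*}

/-- A conjugate of a compact subgroup is compact (conjugation is continuous).
[cite: MochizukiSemiAnbd2006, §0 p.5] -/
theorem isCompact_conjSubgroup (g : Gtp) {K : Subgroup Gtp} (hK : IsCompact (K : Set Gtp)) :
    IsCompact (conjSubgroup g K : Set Gtp) := by
  have hset : (conjSubgroup g K : Set Gtp) = (fun x : Gtp => g * x * g⁻¹) '' (K : Set Gtp) := by
    ext x
    simp [conjSubgroup, MulAut.conj_apply]
  rw [hset]
  exact hK.image (by fun_prop)

/-- **Layer 0.** [SemiAnbd] Rmk 5.3.1 (first sentence) for ALL verticial and edge-like subgroups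
(Def 5.3 (iii): the conjugates of the decomposition groups) follows from compactness and arithmetic
ampleness of the chosen representatives `Π^temp_{𝔊,v} = D.vertGp v`, `Π^temp_{𝔊,b} = D.brGp b`.
[cite: MochizukiSemiAnbd2006, Rmk 5.3.1 p.65] -/
theorem verticialEdgeLikeCompactAmple_of_representatives (D : DecompositionData Gtp V B)
    (aug : Gtp →* PA) (hVc : ∀ v : V, IsCompact (D.vertGp v : Set Gtp))
    (hVa : ∀ v : V, IsArithAmple aug (D.vertGp v)) (hBc : ∀ b : B, IsCompact (D.brGp b : Set Gtp))
    (hBa : ∀ b : B, IsArithAmple aug (D.brGp b)) : VerticialEdgeLikeCompactAmpleStatement D aug := by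
  rintro K (⟨v, g, rfl⟩ | ⟨b, g, rfl⟩)
  · exact ⟨isCompact_conjSubgroup g (hVc v), (isArithAmple_conjSubgroup_iff aug g _).2 (hVa v)⟩
  · exact ⟨isCompact_conjSubgroup g (hBc b), (isArithAmple_conjSubgroup_iff aug g _).2 (hBa b)⟩

end Reduction

/-! ### Layer A, ampleness: the commensurator model -/

/-- An element normalising `H` commensurates it. [cite: MochizukiSemiAnbd2006, §0 p.5] -/
theorem mem_commensurator_of_conjSubgroup_eq {G : Type*} [Group G] {H : Subgroup G} {x : G}
    (h : conjSubgroup x H = H) : x ∈ Subgroup.Commensurable.commensurator H := by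
  rw [Subgroup.Commensurable.commensurator_mem_iff]
  change Subgroup.Commensurable (conjSubgroup x H) H
  rw [h]

/-- If `g` and `k` conjugate `H` to the same subgroup then `k⁻¹ g` normalises `H`
(`conjSubgroup_mul`: abc-iut-w4-d040's `ArithIntersectionWithGeometricProofs`).
[cite: MochizukiSemiAnbd2006, §0 p.5] -/
theorem conjSubgroup_inv_mul_eq_self {G : Type*} [Group G] {H : Subgroup G} {g k : G}
    (h : conjSubgroup g H = conjSubgroup k H) : conjSubgroup (k⁻¹ * g) H = H := by
  rw [conjSubgroup_mul, h, ← conjSubgroup_mul, inv_mul_cancel]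
  change ConjAct.toConjAct (1 : G) • H = H
  rw [map_one, one_smul]

section Ample

variable {Gtp : Type u'} [Group Gtp]
  {PA : Type u''} [Group PA] [TopologicalSpace PA] [IsTopologicalGroup PA]
  {N : Type*} [Group N]

/-- Arithmetic ampleness from LIFTING an open subgroup of `Π_A` into `K`.
[cite: MochizukiSemiAnbd2006, Def 5.3 (i) p.65] -/
theorem isArithAmple_of_forall_exists_lift (aug : Gtp →* PA) (K : Subgroup Gtp) (U : Subgroup PA)
    (hU : IsOpen (U : Set PA)) (hlift : ∀ a ∈ U, ∃ x ∈ K, aug x = a) : IsArithAmple aug K := by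
  refine Subgroup.isOpen_mono (H₁ := U) (fun a ha => ?_) hU
  obtain ⟨x, hx, rfl⟩ := hlift a ha
  exact ⟨x, hx, rfl⟩

/-- **Ampleness of an intersection of two commensurators from simultaneous conjugation.** If over
every `a` in an open `U ≤ Π_A` there is a `g ∈ Π^temp_𝔊` whose conjugation moves the PAIR
`(ι H₁, ι H₂)` exactly as conjugation by some `ι h`, `h ∈ Π^temp_𝔾 = N` (`aug ∘ ι = 1`), then
`C(ι H₁) ⊓ C(ι H₂)` is arithmetically ample: `(ι h)⁻¹ g` normalises both and maps to `a`.
[cite: MochizukiSemiAnbd2006, Rmk 5.3.1 p.65] -/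
theorem isArithAmple_commensurator_inf_of_conjPair (ι : N →* Gtp) (aug : Gtp →* PA)
    (hιaug : ∀ h : N, aug (ι h) = 1) (H₁ H₂ : Subgroup N) (U : Subgroup PA)
    (hU : IsOpen (U : Set PA))
    (hpair : ∀ a ∈ U, ∃ g : Gtp, aug g = a ∧ ∃ h : N,
      conjSubgroup g (H₁.map ι) = conjSubgroup (ι h) (H₁.map ι) ∧
        conjSubgroup g (H₂.map ι) = conjSubgroup (ι h) (H₂.map ι)) :
    IsArithAmple aug (Subgroup.Commensurable.commensurator (H₁.map ι) ⊓
      Subgroup.Commensurable.commensurator (H₂.map ι)) := by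
  refine isArithAmple_of_forall_exists_lift aug _ U hU fun a ha => ?_
  obtain ⟨g, rfl, h, h₁, h₂⟩ := hpair a ha
  refine ⟨(ι h)⁻¹ * g, ⟨mem_commensurator_of_conjSubgroup_eq (conjSubgroup_inv_mul_eq_self h₁),
    mem_commensurator_of_conjSubgroup_eq (conjSubgroup_inv_mul_eq_self h₂)⟩, ?_⟩
  rw [map_mul, map_inv, hιaug, inv_one, one_mul]

/-- **Ampleness of one commensurator from conjugation** (the case `H₁ = H₂` of the previous lemma).
[cite: MochizukiSemiAnbd2006, Rmk 5.3.1 p.65] -/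
theorem isArithAmple_commensurator_of_conj (ι : N →* Gtp) (aug : Gtp →* PA)
    (hιaug : ∀ h : N, aug (ι h) = 1) (H : Subgroup N) (U : Subgroup PA) (hU : IsOpen (U : Set PA))
    (hconj : ∀ a ∈ U, ∃ g : Gtp, aug g = a ∧ ∃ h : N,
      conjSubgroup g (H.map ι) = conjSubgroup (ι h) (H.map ι)) :
    IsArithAmple aug (Subgroup.Commensurable.commensurator (H.map ι)) := by
  have h := isArithAmple_commensurator_inf_of_conjPair ι aug hιaug H H U hU fun a ha => by
    obtain ⟨g, hg, h, hh⟩ := hconj a ha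
    exact ⟨g, hg, h, hh, hh⟩
  rwa [inf_idem] at h

end Ample

/-! ### Layer A for the produced data `decompositionDataOfChart R ι` -/

namespace ProfiniteSemiGraph

variable {𝒢 : ProfiniteSemiGraph.{u}} {c : TemperedPiChart 𝒢}
  {Gtp : Type u'} [Group Gtp]
  {PA : Type u''} [Group PA] [TopologicalSpace PA] [IsTopologicalGroup PA]

/-- **[SemiAnbd] Rmk 5.3.1: the verticial decomposition groups `Π^temp_{𝔊,v}` are arithmetically
ample**, for the data PRODUCED from the tempered chart (`arithVertGp R ι v` = the commensurator of
`ι Π^temp_{𝔾,v}`, p. 65), from: `aug ∘ ι = 1` and `aug` surjective (Prop 5.2 (iv)), Prop 3.6 (iv) at the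
automorphisms `ρ(aug g)` (`hconjV`, the producer's field `conj_verticial`), and Def 5.1 (i)(c) — an open
`U ≤ Π_A` fixing every vertex (`hU`, from the field `exists_open_trivial`).
[cite: MochizukiSemiAnbd2006, Rmk 5.3.1 p.65] -/
theorem isArithAmple_arithVertGp (R : ChartRepresentatives c) (ι : c.G →* Gtp) (aug : Gtp →* PA)
    (actV : PA → 𝒢.graph.Vertex → 𝒢.graph.Vertex) (hιaug : ∀ h : c.G, aug (ι h) = 1)
    (hsurj : Function.Surjective aug)
    (hconjV : ∀ (g : Gtp) (v : 𝒢.graph.Vertex) (H : Subgroup c.G), H ∈ verticialSubgroups c v →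
      ∃ H' ∈ verticialSubgroups c (actV (aug g) v), conjSubgroup g (H.map ι) = H'.map ι)
    (hU : ∃ U : Subgroup PA, IsOpen (U : Set PA) ∧ ∀ a ∈ U, ∀ v, actV a v = v)
    (v : 𝒢.graph.Vertex) : IsArithAmple aug (arithVertGp R ι v) := by
  obtain ⟨U, hUo, hUfix⟩ := hU
  refine isArithAmple_commensurator_of_conj ι aug hιaug (R.Hv v) U hUo fun a ha => ?_
  obtain ⟨g, rfl⟩ := hsurj a
  obtain ⟨H', hH', hgH⟩ := hconjV g v (R.Hv v) (R.Hv_mem v)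
  rw [hUfix _ ha v] at hH'
  -- the verticial subgroups at `v` form one `Π^temp_𝔾`-conjugacy class
  obtain ⟨h, rfl⟩ := exists_conj_of_mem_verticialSubgroups c (R.Hv_mem v) hH'
  exact ⟨g, rfl, h, by rw [hgH, map_conjSubgroup_eq]⟩

/-- **[SemiAnbd] Rmk 5.3.1: the branch decomposition groups `Π^temp_{𝔊,b}` are arithmetically ample**,
for the produced data (`arithBrGp R ι b = arithVertGp R ι v ⊓` the commensurator of `ι Π^temp_{𝔾,b}`,
`b ↦ v`), from `aug ∘ ι = 1`, an open `U ≤ Π_A`, and the PAIR conjugation property `hconjPair`: over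
every `a ∈ U` some `g` conjugates `(ι Π_{𝔾,v}, ι Π_{𝔾,b})` like a single `ι h`, `h ∈ Π^temp_𝔾` — at tree
level: `aug g = a` fixes `v` and `b` (Def 5.1 (i)(c)), so `g · (ṽ, b̃)` lies over `(v, b)` and `Π^temp_𝔾`,
acting transitively on the tree branches over `b`, supplies `h` with `h · (ṽ, b̃) = g · (ṽ, b̃)`.  (The
edge-granular "conjugation carries edge-like subgroups at `e` to edge-like subgroups at `a • e`" does
not suffice when `e` is a loop.) [cite: MochizukiSemiAnbd2006, Rmk 5.3.1 p.65] -/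
theorem isArithAmple_arithBrGp (R : ChartRepresentatives c) (ι : c.G →* Gtp) (aug : Gtp →* PA)
    (hιaug : ∀ h : c.G, aug (ι h) = 1) {b : 𝒢.graph.Branch} {v : 𝒢.graph.Vertex}
    (hb : 𝒢.graph.abuts b = some v) (U : Subgroup PA) (hU : IsOpen (U : Set PA))
    (hconjPair : ∀ a ∈ U, ∃ g : Gtp, aug g = a ∧ ∃ h : c.G,
      conjSubgroup g ((R.Hv v).map ι) = conjSubgroup (ι h) ((R.Hv v).map ι) ∧
        conjSubgroup g ((R.Hb b).map ι) = conjSubgroup (ι h) ((R.Hb b).map ι)) :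
    IsArithAmple aug (arithBrGp R ι b) := by
  rw [arithBrGp_of_abuts R ι hb]
  exact isArithAmple_commensurator_inf_of_conjPair ι aug hιaug (R.Hv v) (R.Hb b) U hU hconjPair

/-- **[SemiAnbd] Rmk 5.3.1, first sentence, for the decomposition data PRODUCED from the tempered
chart** (`decompositionDataOfChart R ι`, a graph: every branch abuts), at LEVEL A: arithmetic ampleness
of every verticial and edge-like subgroup is DERIVED (vertices: `hconjV` + `hU` = the producer's
`conj_verticial` / `exists_open_trivial`; branches: the pair conjugation property `hconjPair`, see
`isArithAmple_arithBrGp`), compactness of the representatives enters as the binders `hVc`, `hBc`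
(LEVEL-B obligations; `isCompact_commensurator_of_thickening` reduces `hVc` to a compact ample
thickening), and Layer 0 transports both to all conjugates. [cite: MochizukiSemiAnbd2006, Rmk 5.3.1 p.65] -/
theorem verticialEdgeLikeCompactAmple_decompositionDataOfChart [TopologicalSpace Gtp]
    [IsTopologicalGroup Gtp] (R : ChartRepresentatives c) (ι : c.G →* Gtp) (aug : Gtp →* PA)
    (actV : PA → 𝒢.graph.Vertex → 𝒢.graph.Vertex) (hιaug : ∀ h : c.G, aug (ι h) = 1)
    (hsurj : Function.Surjective aug)
    (hconjV : ∀ (g : Gtp) (v : 𝒢.graph.Vertex) (H : Subgroup c.G), H ∈ verticialSubgroups c v →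
      ∃ H' ∈ verticialSubgroups c (actV (aug g) v), conjSubgroup g (H.map ι) = H'.map ι)
    (hU : ∃ U : Subgroup PA, IsOpen (U : Set PA) ∧ ∀ a ∈ U, ∀ v, actV a v = v)
    (habuts : ∀ b : 𝒢.graph.Branch, ∃ v, 𝒢.graph.abuts b = some v)
    (hconjPair : ∀ (b : 𝒢.graph.Branch) (v : 𝒢.graph.Vertex), 𝒢.graph.abuts b = some v →
      ∃ U : Subgroup PA, IsOpen (U : Set PA) ∧ ∀ a ∈ U, ∃ g : Gtp, aug g = a ∧ ∃ h : c.G,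
        conjSubgroup g ((R.Hv v).map ι) = conjSubgroup (ι h) ((R.Hv v).map ι) ∧
          conjSubgroup g ((R.Hb b).map ι) = conjSubgroup (ι h) ((R.Hb b).map ι))
    (hVc : ∀ v, IsCompact (arithVertGp R ι v : Set Gtp))
    (hBc : ∀ b, IsCompact (arithBrGp R ι b : Set Gtp)) :
    VerticialEdgeLikeCompactAmpleStatement (decompositionDataOfChart R ι) aug := by
  refine verticialEdgeLikeCompactAmple_of_representatives _ aug hVc
    (isArithAmple_arithVertGp R ι aug actV hιaug hsurj hconjV hU) hBc fun b => ?_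
  obtain ⟨v, hv⟩ := habuts b
  obtain ⟨U, hUo, hpair⟩ := hconjPair b v hv
  exact isArithAmple_arithBrGp R ι aug hιaug hv U hUo hpair

end ProfiniteSemiGraph

/-! ### Layer A, compactness: compact ample thickenings -/

section Compact

variable {Gtp : Type u'} [Group Gtp] [TopologicalSpace Gtp] [IsTopologicalGroup Gtp]
  {PA : Type u''} [Group PA] [TopologicalSpace PA] [IsTopologicalGroup PA] [CompactSpace PA]

/-- **Compactness of a commensurator from a compact arithmetically ample thickening.**  Let
`K ≤ C := C_{Gtp}(H)` with `H` and `K` compact, `aug(K)` open in the compact group `Π_A` (in the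
application `H = ιΠ^temp_{𝔾,v} ≤ K`; neither this inclusion nor continuity of `aug` is used), and
`C ⊓ ker aug ≤ H` (commensurable terminality of `Π^temp_{𝔾,v}` in `Π^temp_𝔾 = ker aug`, [SemiAnbd]
Cor 2.7 (i) / Prop 3.6 (iii), read through the exact sequence of Prop 5.2 (iv)).  Then `C` is a finite
union of the compact sets `H · w · K` (`w ∈ C`), hence compact.  In print `K` is the image of the
profinite fundamental group of the constituent anabelioid `𝔊_v` over an open `U ≤ Π_A` acting trivially.
[cite: MochizukiSemiAnbd2006, Rmk 5.3.1 p.65] -/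
theorem isCompact_commensurator_of_thickening (aug : Gtp →* PA)
    (H K : Subgroup Gtp) (hH : IsCompact (H : Set Gtp)) (hK : IsCompact (K : Set Gtp))
    (hKC : K ≤ Subgroup.Commensurable.commensurator H) (hKa : IsArithAmple aug K)
    (hCT : Subgroup.Commensurable.commensurator H ⊓ aug.ker ≤ H) :
    IsCompact (Subgroup.Commensurable.commensurator H : Set Gtp) := by
  classical
  set C := Subgroup.Commensurable.commensurator H with hC
  -- finitely many left cosets of the open subgroup `aug(K)` cover the compact group `Π_A`
  have hcover : (Set.univ : Set PA) ⊆ ⋃ a : PA, (fun p => a * p) '' (K.map aug : Set PA) := by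
    intro a _
    exact Set.mem_iUnion.2 ⟨a, 1, (K.map aug).one_mem, mul_one a⟩
  obtain ⟨T, hT⟩ := isCompact_univ.elim_finite_subcover (fun a : PA => (fun p => a * p) '' (K.map aug))
    (fun a => (Homeomorph.mulLeft a).isOpenMap _ hKa) hcover
  -- for each coset meeting `aug(C)` choose a representative in `C` (else `1`)
  have hrep : ∀ a : PA, ∃ w : Gtp, w ∈ C ∧
      ((∃ w' ∈ C, aug w' ∈ (fun p => a * p) '' (K.map aug : Set PA)) →
        aug w ∈ (fun p => a * p) '' (K.map aug : Set PA)) := by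
    intro a
    by_cases hex : ∃ w' ∈ C, aug w' ∈ (fun p => a * p) '' (K.map aug : Set PA)
    · obtain ⟨w', hw', hmem⟩ := hex
      exact ⟨w', hw', fun _ => hmem⟩
    · exact ⟨1, C.one_mem, fun h => (hex h).elim⟩
  choose w hwC hwrep using hrep
  -- `C = ⋃_{a ∈ T} H · w a · K`
  have hHC : H ≤ C := le_commensurator_self H
  have hsub : (C : Set Gtp) = ⋃ a ∈ T, (fun p : Gtp × Gtp => p.1 * w a * p.2) '' ((H : Set Gtp) ×ˢ (K : Set Gtp)) := by
    apply le_antisymm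
    · intro x hx
      have hxT := hT (Set.mem_univ (aug x))
      simp only [Set.mem_iUnion] at hxT
      obtain ⟨a, haT, p, hp, hap⟩ := hxT
      have hwa : aug (w a) ∈ (fun p => a * p) '' (K.map aug : Set PA) := hwrep a ⟨x, hx, p, hp, hap⟩
      obtain ⟨q, hq, haq⟩ := hwa
      obtain ⟨kp, hkp, rfl⟩ := hp
      obtain ⟨kq, hkq, rfl⟩ := hq
      -- `aug x = a · aug kp`, `aug (w a) = a · aug kq`, so `x · ((w a) kq⁻¹ kp)⁻¹ ∈ C ⊓ ker aug ≤ H`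
      have hy : x * (w a * (kq⁻¹ * kp))⁻¹ ∈ H := by
        refine hCT (Subgroup.mem_inf.2 ⟨C.mul_mem hx (C.inv_mem (C.mul_mem (hwC a)
          (hKC (K.mul_mem (K.inv_mem hkq) hkp)))), ?_⟩)
        have hap' : aug x = a * aug kp := hap.symm
        have haq' : aug (w a) = a * aug kq := haq.symm
        rw [MonoidHom.mem_ker, map_mul, map_inv, map_mul, map_mul, map_inv, haq', hap']
        group
      refine Set.mem_iUnion₂.2 ⟨a, haT, ⟨x * (w a * (kq⁻¹ * kp))⁻¹, kq⁻¹ * kp⟩,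
        ⟨hy, K.mul_mem (K.inv_mem hkq) hkp⟩, ?_⟩
      simp only
      group
    · intro x hx
      simp only [Set.mem_iUnion] at hx
      obtain ⟨a, -, ⟨p, q⟩, ⟨hp, hq⟩, rfl⟩ := hx
      exact C.mul_mem (C.mul_mem (hHC hp) (hwC a)) (hKC hq)
  rw [hsub]
  exact T.finite_toSet.isCompact_biUnion fun a _ => (hH.prod hK).image (by fun_prop)

end Compact

/-! ### Tree level: stabilisers under open-kernel actions are closed -/

section Closed

variable {Gtp : Type u'} [Group Gtp] [TopologicalSpace Gtp] [IsTopologicalGroup Gtp]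

/-- Under an action `ρ : Gtp →* M` with OPEN kernel, the set of elements acting in a prescribed way on
a point (`P (ρ g)` for any predicate `P`) is clopen: it is a union of cosets of the kernel.
[cite: MochizukiSemiAnbd2006, §5 p.65] -/
theorem isClopen_setOf_apply_of_isOpen_ker {M : Type*} [Group M] (ρ : Gtp →* M)
    (hker : IsOpen (ρ.ker : Set Gtp)) (P : M → Prop) : IsClopen {g : Gtp | P (ρ g)} := by
  -- the set is saturated for right multiplication by the open kernel
  have hopen : ∀ Q : M → Prop, IsOpen {g : Gtp | Q (ρ g)} := by
    intro Q
    rw [isOpen_iff_mem_nhds]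
    intro g hg
    have h1 : (fun k => g * k) '' (ρ.ker : Set Gtp) ∈ 𝓝 g := by
      have := (Homeomorph.mulLeft g).isOpenMap _ hker
      refine this.mem_nhds ⟨1, ρ.ker.one_mem, mul_one g⟩
    refine Filter.mem_of_superset h1 ?_
    rintro _ ⟨k, hk, rfl⟩
    show Q (ρ (g * k))
    rw [map_mul, (MonoidHom.mem_ker).1 hk, mul_one]
    exact hg
  refine ⟨?_, hopen P⟩
  rw [← isOpen_compl_iff, Set.compl_setOf]
  exact hopen fun m => ¬ P m

/-- **A common stabiliser under open-kernel level actions is closed**: if membership in `W` is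
equivalent to acting in a prescribed way at every level `j` (the producer's dictionary fields `fix` /
`stab`: `g ∈ W ↔ ∀ j, (act j g) · x j = x j`) and every `act j` has open kernel, then `W` is closed
(an intersection of clopen sets).  [cite: MochizukiSemiAnbd2006, §5 p.65] -/
theorem isClosed_of_mem_iff_forall_apply {J : Type*} {M : J → Type*} [∀ j, Group (M j)]
    (ρ : ∀ j, Gtp →* M j) (hker : ∀ j, IsOpen ((ρ j).ker : Set Gtp)) (P : ∀ j, M j → Prop)
    (W : Subgroup Gtp) (hW : ∀ g : Gtp, g ∈ W ↔ ∀ j, P j (ρ j g)) : IsClosed (W : Set Gtp) := by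
  have hset : (W : Set Gtp) = ⋂ j, {g : Gtp | P j (ρ j g)} := by
    ext g
    simp only [SetLike.mem_coe, Set.mem_iInter, Set.mem_setOf_eq]
    exact hW g
  rw [hset]
  exact isClosed_iInter fun j => (isClopen_setOf_apply_of_isOpen_ker (ρ j) (hker j) (P j)).1

end Closed

end Literature.AnabelianGeometry.SemiGraphs
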